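import Mathlib

/-!
# Beta / CapacitanceSplit — the CENTRE-ALIAS CAPACITANCE SPLIT (W1)–(W2) as typed algebra: push-through Woodbury with a SINGULAR middle
# factor, `k₀⁻¹ = 𝒜 − 𝒜 U X V 𝒜`, `det k₀ = det k_off · det 𝒦̃`, `det (⊕_c 𝒦₄) = (det 𝒦₄)^{#colours}`, and the norm composition
# `‖k₀⁻¹‖ ≤ ‖𝒜‖ (1 + ‖U‖ ‖X‖ ‖V‖ ‖𝒜‖)`
# (β sub-cell, CAP lane «KERNEL ALGEBRA + EXPORT», lineage `b2b-balaban-beta-cap3`, gen 10; answers an5-g21 census V17 «the split is NOT typed»)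

WHY.  CAP-KERNEL §4.15 (b): with `k_off := k₀ − U N V` (the centre-alias-deflated Hessian, the object of `Beta/SaddleInverse*`), `𝒜 := k_off⁻¹`,
`𝒦̃ := 1 + V 𝒜 U N` (`= ⊕₃ 𝒦₄` by colour) and `X := N 𝒦̃⁻¹`, the memo's identities are (W1) `k₀⁻¹ ≡ 𝒜 − 𝒜 U X V 𝒜` and (W2)
`det k₀ ≡ det k_off · (det 𝒦₄)³` (validated there to 1e-13 in floats).  The middle factor `N` (the centre-alias block `Δ₀·1 − ∂₀ ⊗ ∂♭₀`)
is SINGULAR, so Mathlib's `Matrix.add_mul_mul_inv_eq_sub` (which needs `N⁻¹`) does not apply; the push-through form below needs only a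
right inverse of `k_off` and of `𝒦̃`.  an5-g21's census (CAPK-CENSUS-g21 c570ff3702900664, V17) records that its route-A rows take
`A = k₀` literally and that a `k_off`-based bound needs exactly (W1), (W2) typed plus the composition `‖k₀⁻¹‖ ≤ ‖𝒜‖(1 + ‖U‖‖X‖‖V‖‖𝒜‖)`;
all four are here, generically (any commutative ring; the norm step over `ℂ` in the Euclidean operator norm).  [folklore].

## What is proved (`n` = variables, `m` = centre-alias slots, `c` = colours — finite types with decidable equality; `R` a commutative ring;
`Koff : Matrix n n R`, `U : Matrix n m R`, `Nm : Matrix m m R`, `V : Matrix m n R`, `A Ki` candidate inverses)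
* §1 `capMat V A U Nm := 1 + V * A * U * Nm` (`𝒦̃`); **`add_mul_woodburyPT`**: `Koff * A = 1`, `capMat * Ki = 1` ⇒
  `(Koff + U Nm V) * (A − A U (Nm Ki) V A) = 1` (push-through Woodbury, `Nm` arbitrary — singular allowed); `isUnit_det_add_of_capMat`;
  **`inv_add_eq_woodburyPT`**: `(Koff + U Nm V)⁻¹ = A − A U (Nm Ki) V A` (W1).
* §2 `add_eq_mul_one_add : Koff + U Nm V = Koff * (1 + A U Nm V)`; **`det_add_eq_det_mul_det_capMat`**: `det (Koff + U Nm V) = det Koff * det 𝒦̃` (W2, via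
  Sylvester `Matrix.det_one_add_mul_comm`); `isUnit_det_add_iff` (given `IsUnit Koff.det`: `k₀` invertible iff `𝒦̃` is);
  `det_blockDiagonal_const : det (blockDiagonal fun _ : c => K) = det K ^ card c` and `det_kronecker_one : det (K ⊗ₖ 1) = det K ^ card c`
  (the colour factorisation `(det 𝒦₄)³`, in block-diagonal and in Kronecker form).
* §3 (`R = ℂ`, `Matrix.Norms.L2Operator`) **`norm_woodburyPT_le`**: `‖A − A U X V A‖ ≤ ‖A‖ (1 + ‖U‖ ‖X‖ ‖V‖ ‖A‖)` and
  `norm_inv_add_le`: under §1's hypotheses `‖(Koff + U Nm V)⁻¹‖ ≤ ‖A‖ (1 + ‖U‖ ‖Nm Ki‖ ‖V‖ ‖A‖)`.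

HONEST FRAMING.  Finite-dimensional identities and one triangle inequality, [folklore]; no cited fact, no number.  This module proves NO bound
on any object of the cell — `‖𝒜‖`, `‖𝒦̃⁻¹‖` are INPUTS —, NO number of the β-function, NO statement about Bałaban's operators, and discharges
NOTHING of `FlowStep.BetaPertH`; (W3) (`det 𝒦₄ ≡` the ZROW object) is an identification of two typed tables and is NOT here.  Discharging
`BetaPertH` would make Bałaban's ultraviolet stability unconditional — NOT the continuum limit and NOT the Clay problem.  0 `sorry`, 0 cite tags.
-/

namespace Summit.QuantumFields.BalabanUV.Beta.CapacitanceSplit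

open Matrix
open scoped Kronecker

variable {R : Type*} [CommRing R]
variable {n m : Type*} [Fintype n] [Fintype m] [DecidableEq n] [DecidableEq m]

/-! ## §1 Push-through Woodbury with a singular middle factor (W1) -/

/-- The CAPACITANCE MATRIX `𝒦̃ := 1 + V 𝒜 U N` of the centre-alias split. -/
def capMat (V : Matrix m n R) (A : Matrix n n R) (U : Matrix n m R) (Nm : Matrix m m R) : Matrix m m R :=
  1 + V * A * U * Nm

variable {Koff A : Matrix n n R} {U : Matrix n m R} {Nm Ki : Matrix m m R} {V : Matrix m n R}

omit [DecidableEq n] in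
/-- [folklore] The push-through step: `(1 + N V 𝒜 U) · (N 𝒦̃⁻¹) = N`. -/
theorem one_add_mul_pushThrough (hK : capMat V A U Nm * Ki = 1) :
    (1 + Nm * V * A * U) * (Nm * Ki) = Nm := by
  have e : (1 + Nm * V * A * U) * Nm = Nm * capMat V A U Nm := by
    simp only [capMat, Matrix.add_mul, Matrix.mul_add, Matrix.one_mul, Matrix.mul_one, Matrix.mul_assoc]
  rw [← Matrix.mul_assoc, e, Matrix.mul_assoc, hK, Matrix.mul_one]

/-- [folklore] PUSH-THROUGH WOODBURY, right-inverse form: `k_off 𝒜 = 1`, `𝒦̃ Ki = 1` ⇒ `(k_off + U N V)(𝒜 − 𝒜 U (N Ki) V 𝒜) = 1`, for an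
ARBITRARY (possibly singular) middle factor `N`. -/
theorem add_mul_woodburyPT (hA : Koff * A = 1) (hK : capMat V A U Nm * Ki = 1) :
    (Koff + U * Nm * V) * (A - A * U * (Nm * Ki) * V * A) = 1 := by
  have h1 : Koff * (A - A * U * (Nm * Ki) * V * A) = 1 - U * (Nm * Ki) * V * A := by
    rw [Matrix.mul_sub, hA]
    simp only [Matrix.mul_assoc]
    rw [← Matrix.mul_assoc Koff A, hA, Matrix.one_mul]
  have h2 : U * Nm * V * (A - A * U * (Nm * Ki) * V * A) = U * (Nm - Nm * V * A * U * (Nm * Ki)) * V * A := by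
    simp only [Matrix.mul_sub, Matrix.sub_mul, Matrix.mul_assoc]
  have h3 : Nm - Nm * V * A * U * (Nm * Ki) = Nm * Ki := by
    have e := one_add_mul_pushThrough (A := A) (U := U) (V := V) hK
    rw [Matrix.add_mul, Matrix.one_mul] at e
    exact sub_eq_iff_eq_add.mpr e.symm
  rw [Matrix.add_mul, h1, h2, h3, sub_add_cancel]

/-- [folklore] … hence `k₀ = k_off + U N V` is invertible, -/
theorem isUnit_det_add_of_capMat (hA : Koff * A = 1) (hK : capMat V A U Nm * Ki = 1) : IsUnit (Koff + U * Nm * V).det :=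
  Matrix.isUnit_det_of_right_inverse (add_mul_woodburyPT hA hK)

/-- [folklore] (W1) `k₀⁻¹ = 𝒜 − 𝒜 U X V 𝒜` with `X := N 𝒦̃⁻¹` (here `N Ki` for any right inverse `Ki` of `𝒦̃`). -/
theorem inv_add_eq_woodburyPT (hA : Koff * A = 1) (hK : capMat V A U Nm * Ki = 1) :
    (Koff + U * Nm * V)⁻¹ = A - A * U * (Nm * Ki) * V * A :=
  Matrix.inv_eq_right_inv (add_mul_woodburyPT hA hK)

/-! ## §2 Determinant factorisation (W2) and the colour power -/

omit [DecidableEq m] in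
/-- [folklore] `k_off + U N V = k_off (1 + 𝒜 U N V)` when `k_off 𝒜 = 1`. -/
theorem add_eq_mul_one_add (hA : Koff * A = 1) : Koff + U * Nm * V = Koff * (1 + A * U * Nm * V) := by
  rw [Matrix.mul_add, Matrix.mul_one]
  simp only [Matrix.mul_assoc]
  rw [← Matrix.mul_assoc Koff A, hA, Matrix.one_mul]

/-- [folklore] (W2) `det k₀ = det k_off · det 𝒦̃` (Sylvester's `det (1 + P Q) = det (1 + Q P)` moves the centre-alias factor through). -/
theorem det_add_eq_det_mul_det_capMat (hA : Koff * A = 1) :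
    (Koff + U * Nm * V).det = Koff.det * (capMat V A U Nm).det := by
  rw [add_eq_mul_one_add hA, Matrix.det_mul, Matrix.det_one_add_mul_comm, capMat]
  simp only [Matrix.mul_assoc]

/-- [folklore] … so, `k_off` being invertible, `k₀` is invertible iff the capacitance matrix is. -/
theorem isUnit_det_add_iff (hA : Koff * A = 1) : IsUnit (Koff + U * Nm * V).det ↔ IsUnit (capMat V A U Nm).det := by
  rw [det_add_eq_det_mul_det_capMat hA, IsUnit.mul_iff]
  exact ⟨fun h => h.2, fun h => ⟨Matrix.isUnit_det_of_right_inverse hA, h⟩⟩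

omit [Fintype n] [DecidableEq n] in
/-- [folklore] The colour factorisation: a block-diagonal matrix with `card c` EQUAL blocks has determinant `det K ^ card c`
(`𝒦̃ = ⊕₃ 𝒦₄ ⇒ det 𝒦̃ = (det 𝒦₄)³`). -/
theorem det_blockDiagonal_const {c : Type*} [Fintype c] [DecidableEq c] (K : Matrix m m R) :
    (Matrix.blockDiagonal fun _ : c => K).det = K.det ^ Fintype.card c := by
  rw [Matrix.det_blockDiagonal, Finset.prod_const, Finset.card_univ]

omit [Fintype n] [DecidableEq n] in
/-- [folklore] The same in Kronecker form (`k₀ = K^{U(1)} ⊗ 1₃` ⇒ `𝒦̃ = 𝒦₄ ⊗ 1₃`): `det (K ⊗ₖ 1) = det K ^ card c`. -/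
theorem det_kronecker_one {c : Type*} [Fintype c] [DecidableEq c] (K : Matrix m m R) :
    (K ⊗ₖ (1 : Matrix c c R)).det = K.det ^ Fintype.card c := by
  rw [Matrix.det_kronecker, Matrix.det_one, one_pow, mul_one]

/-! ## §3 The norm composition (Euclidean operator norm) -/

section Norm

open scoped Matrix.Norms.L2Operator

/-- [folklore] `‖𝒜 − 𝒜 U X V 𝒜‖ ≤ ‖𝒜‖ (1 + ‖U‖ ‖X‖ ‖V‖ ‖𝒜‖)`. -/
theorem norm_woodburyPT_le (A : Matrix n n ℂ) (U : Matrix n m ℂ) (X : Matrix m m ℂ) (V : Matrix m n ℂ) :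
    ‖A - A * U * X * V * A‖ ≤ ‖A‖ * (1 + ‖U‖ * ‖X‖ * ‖V‖ * ‖A‖) := by
  have h : ‖A * U * X * V * A‖ ≤ ‖A‖ * ‖U‖ * ‖X‖ * ‖V‖ * ‖A‖ := by
    calc ‖A * U * X * V * A‖ ≤ ‖A * U * X * V‖ * ‖A‖ := l2_opNorm_mul _ _
      _ ≤ ‖A * U * X‖ * ‖V‖ * ‖A‖ := by gcongr; exact l2_opNorm_mul _ _
      _ ≤ ‖A * U‖ * ‖X‖ * ‖V‖ * ‖A‖ := by gcongr; exact l2_opNorm_mul _ _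
      _ ≤ ‖A‖ * ‖U‖ * ‖X‖ * ‖V‖ * ‖A‖ := by gcongr; exact l2_opNorm_mul _ _
  calc ‖A - A * U * X * V * A‖ ≤ ‖A‖ + ‖A * U * X * V * A‖ := norm_sub_le _ _
    _ ≤ ‖A‖ + ‖A‖ * ‖U‖ * ‖X‖ * ‖V‖ * ‖A‖ := by gcongr
    _ = ‖A‖ * (1 + ‖U‖ * ‖X‖ * ‖V‖ * ‖A‖) := by ring

/-- [folklore] THE COMPOSITION LEAF of census V17: under §1's hypotheses `‖k₀⁻¹‖ ≤ ‖𝒜‖ (1 + ‖U‖ ‖N 𝒦̃⁻¹‖ ‖V‖ ‖𝒜‖)` — the INPUTS being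
bounds on `‖𝒜‖ = ‖k_off⁻¹‖` and `‖N 𝒦̃⁻¹‖` (certified by nobody here). -/
theorem norm_inv_add_le {Koff A : Matrix n n ℂ} {U : Matrix n m ℂ} {Nm Ki : Matrix m m ℂ} {V : Matrix m n ℂ} (hA : Koff * A = 1)
    (hK : capMat V A U Nm * Ki = 1) :
    ‖(Koff + U * Nm * V)⁻¹‖ ≤ ‖A‖ * (1 + ‖U‖ * ‖Nm * Ki‖ * ‖V‖ * ‖A‖) := by
  rw [inv_add_eq_woodburyPT hA hK]
  exact norm_woodburyPT_le A U (Nm * Ki) V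

end Norm

end Summit.QuantumFields.BalabanUV.Beta.CapacitanceSplit
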